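import Literature.AnabelianGeometry.AbsoluteAnabelian.AbsTopICharacterRankWeightDuality
import HarnessLib

/-!
# [AbsTopI] Lemma 4.5 (iii) for the GENERAL Poincaré extension `0 → M^{cusp}⊗ℚ_l → H^{ab}⊗ℚ_l → M_{Ḡ}⊗ℚ_l → 0`:
# sub-DAG inputs A3 / A7 / A9 DERIVED from the [CombGC] Prop. 1.3 + Prop. 2.4 (ii) SHAPE

Proof-only companion of `AbsTopICharacterRank.lean` (S. Mochizuki, *Topics in Absolute Anabelian
Geometry I: Generalities* [MochizukiAbsTopI2012], Lemma 4.5 (iii), kurims manuscript p. 54, printed proof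
p. 55 l. 13–19 "follows immediately from [Mzk12], Proposition 2.4, (iv), (vii); the proof of [Mzk12],
Corollary 2.7, (i)") and of the sub-DAG `AbsTopICuspidalDecompositionSub.lean` (rows A3 `DetSqQuasiCyclotomic`,
A7 `RealisedWeightsSymmetric`, A9 `CuspCountViaWeights` = the three cited [CombGC] INPUTS; [CombGC] =
[MochizukiCombGC2007], kurims `paper:url-6994f81053dc`, Prop. 1.3 + Rmk. 1.3.1 pp. 9–10, Def. 2.3 p. 18,
Prop. 2.4 + proof pp. 19–20, Cor. 2.7 (i) + proof pp. 22–23, read on the page), cell abc-iut, block F, seat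
abc-iut-f-062 (FACT-LIST schemata F-0222 `Lem45iii_cuspCount` · F-0223 `Lem45iii_cycloClass` · F-0224
`Lem45iii_det`).  Sequel of `AbsTopICharacterRankWeightDuality.lean`.

WHAT IS PROVED.  [CombGC]'s own proofs of Prop. 2.4 (iii)/(vii) and of the count in Cor. 2.7 (i) use exactly
two structural inputs about `M_G ⊗ ℚ_l` (here, for the ONE-VERTEX semi-graph of a smooth affine hyperbolic
curve, `V = H^{ab} ⊗ ℚ_l` with its `G`-action `ρV`):
 (C) Prop. 2.4 (ii) + Rmk. 1.3.1: the cuspidal part `C := M^{cusp} ⊗ ℚ_l ≤ V` is a STABLE QUASI-TORAL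
     submodule ("`M(−1)` quasi-trivial": an open subgroup of finite index acts on `C` through the scalar
     character `χ^{cyclo}`), of rank `r − 1` (`r` = number of cusps);
 (P) Prop. 1.3 (applied to the compactification, Rmk. 1.1.6): `V/C = M_{Ḡ} ⊗ ℚ_l` carries a `G`-EQUIVARIANT
     NONDEGENERATE `χ^{cyclo}`-VALUED BILINEAR PAIRING (the cup product into `H² ≅ ℚ_l(1)`).
For EVERY finite-dimensional `V` over any field with data of this shape — hypotheses stated on abstract
binders: `hC : IsStable ρV C`, `hCt` (quasi-torality of `C`), a representation `ρP` on `V ⧸ C` intertwined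
with `ρV` by `C.mkQ` (it always exists: `exists_quotientRepresentation`), a pairing
`B : V/C →ₗ V/C →ₗ K` with `B(gp, gq) = χ^{cyclo}(g)·B(p, q)` and `B(p, ·) = 0 ⇒ p = 0` — we PROVE:
* A3 `detSqQuasiCyclotomic_of_poincareExtension` (Prop. 2.4 (iii)): `det(V)² = (χ^{cyclo})^{dim V + dim C}`
  on the open subgroup where `C` is isotypic (`det V = det C · det V/C` by Mathlib's block-triangular
  `LinearMap.det_eq_det_mul_det`; `det(V/C)² = χ^{dim V/C}` by duality), `0 < m ≤ 2 dim V` (needs `V ≠ 0`);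
* A7 `realisedWeightsSymmetric_of_poincareExtension` (Prop. 2.4 (vii)): for NON-DEGENERATE `χ^{cyclo}` and
  `C ≠ 0` ("`G` has cusps" / "sufficiently small": `r ≥ 2`), the weights realised by `V ⊕ ℚ_l` are exactly
  `{0, 2} ∪ w_l(V/C)` — FINITE and invariant under `λ ↦ 2 − λ` (verbatim the printed argument
  "`E_{G′} = {0, 2} ∪ E′_{G′}` … by Proposition 1.3 … `E′_{G′}` is invariant");
* A9 `cuspCountViaWeights_of_poincareExtension` (Cor. 2.7 (i) proof, "the rank of `M^{cusp}_{G′}` may be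
  computed as the difference between the `l`-weight `2` and `l`-weight `0` ranks"): `τ(V((χ^{cyclo})⁻¹)) −
  τ(V) = dim C`, i.e. the count holds with `r := dim C + 1` cusps;
and hence, through the PROVED assembly sub-nodes A4 / A8 (+A1, A5, A6) / A11 (+A10) (p414615, p414703),
the THREE SENTENCES of Lemma 4.5 (iii): `lem45iii_det_of_poincareExtension`,
`lem45iii_cycloClass_of_poincareExtension`, `lem45iii_cuspCount_of_poincareExtension … (dim C + 1)`, and
`dChi_of_poincareExtension : d_{χ^{cyclo}}(V) = dim C` (= `r − 1`).
NO purity / Riemann-hypothesis (weight-`1`) input is used — in agreement with print, whose proof of (vii)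
invokes Prop. 1.3 (duality) only.  This REPLACES the split algebraic MODELS of the trunk
(`…CyclotomicModel`, `…SplitModel`, `…CurveShape`: direct sums of scalar pieces) by the general non-split
extension, which is the shape `H^{ab} ⊗ ℚ_l = T_l` of the generalised Jacobian actually has; the
necessity of `C ≠ 0` for the second and third sentences is `AbsTopICharacterRankProperShape.lean`.
RESIDUAL for F-0222/F-0223/F-0224 at print's instance (honest scope): the étale-`π₁` facts (C) and (P)
for `H ⊆ Δ_X` (cuspidal inertia `≅ ℤ_l(1)` generating a rank-`(r−1)` submodule of `H^{ab} ⊗ ℚ_l`;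
Poincaré duality on `H¹` of the smooth compactification) and `l`-cyclotomic fullness of `k` — FOUNDATIONS
row 12 (étale-`π₁` model), not constructed here.  No new definitions.  HONEST FRAMING: refereed pre-IUT
anabelian geometry (linear algebra of `G`-modules); typed ≠ proved for the geometric instance; nothing here
bears on [IUTchIII] Cor. 3.12.
-/

noncomputable section

open scoped Classical

namespace Literature.AnabelianGeometry.AbsoluteAnabelian.AbsTopI

universe u v w

section PoincareExtension

variable {G : Type u} [Group G] [TopologicalSpace G]
variable {K : Type v} [Field K]
variable {V : Type w} [AddCommGroup V] [Module K V]

/-! ### §1. The Poincaré extension `0 → C → V → V/C → 0`: `C` quasi-toral ("`M^{cusp} ⊗ ℚ_l`",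
[CombGC] Prop. 2.4 (ii), Rmk. 1.3.1: rank `r − 1`), `V/C` self-dual ("`M_{Ḡ}` of the compactification",
Prop. 1.3) — A3, A7, A9 and the three sentences of [AbsTopI] Lemma 4.5 (iii) -/

/-- `τ` is additive along the extension, for every twist: `τ(V(φ)) = τ(C(φ)) + τ((V/C)(φ))`.
[cite: MochizukiAbsTopI2012, Lemma 4.5 (ii) p.54] [cite: MochizukiCombGC2007, Def. 2.3 (i) p.18] -/
theorem quasiTrivialRank_twist_eq_add [FiniteDimensional K V] {ρV : G →* (V ≃ₗ[K] V)}
    {C : Submodule K V} (hC : IsStable ρV C) {ρC : G →* (↥C ≃ₗ[K] ↥C)}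
    (hρC : ∀ (g : G) (c : ↥C), ((ρC g c : ↥C) : V) = ρV g c)
    {ρP : G →* ((V ⧸ C) ≃ₗ[K] (V ⧸ C))} (hρP : ∀ (g : G) (m : V), ρP g (C.mkQ m) = C.mkQ (ρV g m))
    (φ : G →* Kˣ) :
    quasiTrivialRank (twist ρV φ) = quasiTrivialRank (twist ρC φ) + quasiTrivialRank (twist ρP φ) :=
  quasiTrivialRank_eq_add_of_exact (twist ρV φ) ((isStable_twist_iff ρV φ C).2 hC) (twist ρC φ)
    (fun g x => by rw [twist_apply, twist_apply, Submodule.coe_smul, hρC])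
    (twist ρP φ) (fun g m => by rw [twist_apply, twist_apply, hρP, map_smul])

omit [TopologicalSpace G] in
/-- `det` is multiplicative along the extension: `det V(g) = det C(g) · det (V/C)(g)` (Mathlib's
block-triangular `LinearMap.det_eq_det_mul_det`). [cite: MochizukiCombGC2007, Prop. 2.4 (iii) p.19] -/
theorem detChar_eq_mul_of_extension [FiniteDimensional K V] {ρV : G →* (V ≃ₗ[K] V)}
    {C : Submodule K V} (hC : IsStable ρV C) {ρC : G →* (↥C ≃ₗ[K] ↥C)}
    (hρC : ∀ (g : G) (c : ↥C), ((ρC g c : ↥C) : V) = ρV g c)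
    {ρP : G →* ((V ⧸ C) ≃ₗ[K] (V ⧸ C))} (hρP : ∀ (g : G) (m : V), ρP g (C.mkQ m) = C.mkQ (ρV g m))
    (g : G) : detChar ρV g = detChar ρC g * detChar ρP g := by
  apply Units.ext
  rw [Units.val_mul]
  show ((LinearEquiv.det (ρV g) : Kˣ) : K) =
    ((LinearEquiv.det (ρC g) : Kˣ) : K) * ((LinearEquiv.det (ρP g) : Kˣ) : K)
  rw [LinearEquiv.coe_det, LinearEquiv.coe_det, LinearEquiv.coe_det]
  have he : C ≤ C.comap ((ρV g : V ≃ₗ[K] V) : V →ₗ[K] V) := fun c hc => hC g c hc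
  rw [LinearMap.det_eq_det_mul_det C ((ρV g : V ≃ₗ[K] V) : V →ₗ[K] V) he]
  congr 1
  · congr 1
    apply LinearMap.ext
    intro c
    apply Subtype.ext
    rw [LinearMap.coe_restrict_apply, LinearEquiv.coe_coe, LinearEquiv.coe_coe, hρC]
  · congr 1
    apply Submodule.linearMap_qext
    apply LinearMap.ext
    intro m
    rw [LinearMap.comp_apply, LinearMap.comp_apply, LinearEquiv.coe_coe, hρP, Submodule.mkQ_apply,
      Submodule.mapQ_apply, LinearEquiv.coe_coe, Submodule.mkQ_apply]

/-- On the quasi-toral `C` the subrepresentation acts by `χ^{cyclo}` on an open subgroup of finite index.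
[cite: MochizukiCombGC2007, Prop. 2.4 (ii) p.19] -/
theorem scalarOn_sub_of_quasiToral {ρV : G →* (V ≃ₗ[K] V)} {χcyclo : G →* Kˣ}
    {C : Submodule K V} {ρC : G →* (↥C ≃ₗ[K] ↥C)}
    (hρC : ∀ (g : G) (c : ↥C), ((ρC g c : ↥C) : V) = ρV g c)
    (hCt : ∃ U : Subgroup G, IsOpen (U : Set G) ∧ U.FiniteIndex ∧
      ∀ g ∈ U, ∀ c ∈ C, ρV g c = (χcyclo g : K) • c) :
    ∃ U : Subgroup G, IsOpen (U : Set G) ∧ U.FiniteIndex ∧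
      ∀ g ∈ U, ∀ c : ↥C, ρC g c = (χcyclo g : K) • c := by
  obtain ⟨U, hU, hfi, hact⟩ := hCt
  exact ⟨U, hU, hfi, fun g hg c => Subtype.ext (by rw [hρC, Submodule.coe_smul, hact g hg c c.2])⟩

/-- **SUB-NODE A7 ([CombGC] Prop. 2.4 (vii)) DERIVED for the Poincaré extension**: for non-degenerate
`χ^{cyclo}`, a NONZERO stable quasi-toral `C ≤ V` ("`G` has cusps", `r ≥ 2`: `M^{cusp} ≠ 0`) and a
nondegenerate equivariant `χ^{cyclo}`-valued pairing on `V/C`, the weights realised by `V ⊕ ℚ_l` are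
`{0, 2} ∪ w_l(V/C)` — FINITE and invariant under `λ ↦ 2 − λ`. (Print: "`E_{G′} = {0, 2} ∪ E′_{G′}` …
by Proposition 1.3 … `E′_{G′}` is invariant"; no purity / weight-`1` input is used.)
[cite: MochizukiCombGC2007, Prop. 2.4 (vii) p.20] [cite: MochizukiAbsTopI2012, Lemma 4.5 (iii) p.54] -/
theorem realisedWeightsSymmetric_of_poincareExtension [FiniteDimensional K V] (χcyclo : G →* Kˣ)
    (hcyc : ∀ U : Subgroup G, IsOpen (U : Set G) → U.FiniteIndex →
      ∀ a : ℤ, a ≠ 0 → ∃ g ∈ U, χcyclo g ^ a ≠ 1)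
    (ρV : G →* (V ≃ₗ[K] V)) {C : Submodule K V} (hC : IsStable ρV C) (hC0 : C ≠ ⊥)
    (hCt : ∃ U : Subgroup G, IsOpen (U : Set G) ∧ U.FiniteIndex ∧
      ∀ g ∈ U, ∀ c ∈ C, ρV g c = (χcyclo g : K) • c)
    (ρP : G →* ((V ⧸ C) ≃ₗ[K] (V ⧸ C))) (hρP : ∀ (g : G) (m : V), ρP g (C.mkQ m) = C.mkQ (ρV g m))
    (B : (V ⧸ C) →ₗ[K] (V ⧸ C) →ₗ[K] K)
    (hB : ∀ (g : G) (p q : V ⧸ C), B (ρP g p) (ρP g q) = (χcyclo g : K) * B p q)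
    (hBl : ∀ p : V ⧸ C, (∀ q : V ⧸ C, B p q = 0) → p = 0) :
    RealisedWeightsSymmetric χcyclo ρV := by
  obtain ⟨ρC, hρC⟩ := exists_subrepresentation ρV hC
  have hσC := scalarOn_sub_of_quasiToral hρC hCt
  have hadd := fun φ => quasiTrivialRank_twist_eq_add hC hρC hρP φ
  -- the realised weights are `{0, 2} ∪ w_l(V/C)`
  set S : Set ℚ := {w | ∃ ψ : G →* Kˣ, IsQCyclotomicOfWeightK χcyclo ψ w ∧
      quasiTrivialRank (twist ρP ψ⁻¹) ≠ 0} with hS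
  have key : ∀ w, RealisedWeight χcyclo ρV w ↔ w = 0 ∨ w = 2 ∨ w ∈ S := by
    intro w
    rw [realisedWeight_iff_zero_or χcyclo hcyc ρV w]
    refine or_congr_right ⟨?_, ?_⟩
    · rintro ⟨ψ, hψ, hne⟩
      rw [hadd] at hne
      by_cases hCz : quasiTrivialRank (twist ρC ψ⁻¹) = 0
      · rw [hCz, zero_add] at hne
        exact Or.inr ⟨ψ, hψ, hne⟩
      · exact Or.inl (weight_eq_two_of_quasiToral hcyc hσC hψ hCz)
    · rintro (rfl | ⟨ψ, hψ, hne⟩)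
      · refine ⟨χcyclo, (cycloWeightTwoTrivialWeightZero_holds χcyclo).1, ?_⟩
        rw [hadd, quasiTrivialRank_twist_inv_of_quasiToral hσC]
        have : Module.finrank K ↥C ≠ 0 := fun h0 => hC0 (Submodule.finrank_eq_zero.1 h0)
        omega
      · refine ⟨ψ, hψ, ?_⟩
        rw [hadd]
        omega
  have hSsymm : ∀ w, w ∈ S → (2 - w) ∈ S := by
    rintro w ⟨ψ, hψ, hne⟩
    refine ⟨χcyclo * ψ⁻¹, isQCyclotomicOfWeightK_cyclo_mul_inv hψ, ?_⟩
    rwa [← quasiTrivialRank_twist_inv_eq_of_pairing ρP B hB hBl ψ]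
  refine ⟨?_, fun w => ?_⟩
  · refine (((Set.finite_singleton (0 : ℚ)).union (Set.finite_singleton 2)).union
      (finite_weights hcyc ρP)).subset ?_
    intro w hw
    rcases (key w).1 hw with rfl | rfl | h
    · exact Or.inl (Or.inl rfl)
    · exact Or.inl (Or.inr rfl)
    · exact Or.inr h
  · rw [key, key]
    constructor
    · rintro (rfl | rfl | h)
      · exact Or.inr (Or.inl (by norm_num))
      · exact Or.inl (by norm_num)
      · exact Or.inr (Or.inr (hSsymm w h))
    · rintro (h | h | h)
      · exact Or.inr (Or.inl (by linarith))
      · exact Or.inl (by linarith)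
      · have := hSsymm _ h
        rw [sub_sub_cancel] at this
        exact Or.inr (Or.inr this)

/-- **SUB-NODE A9 (the COUNT in [CombGC]'s proof of Cor. 2.7 (i)) DERIVED for the Poincaré extension**:
"the rank of `M^{cusp}` may be computed as the difference between the `l`-weight `2` and `l`-weight `0`
ranks" — `τ(V((χ^{cyclo})⁻¹)) − τ(V) = dim C` (the `V/C`-contributions cancel by duality, `C` contributes
`dim C − 0`), so with `r := dim C + 1` cusps (Rmk. 1.3.1: `rank M^{cusp} = r − 1`) the count reads `r`.
[cite: MochizukiCombGC2007, Cor. 2.7 (i) proof p.23] [cite: MochizukiAbsTopI2012, Lemma 4.5 (iii) p.54] -/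
theorem cuspCountViaWeights_of_poincareExtension [FiniteDimensional K V] (χcyclo : G →* Kˣ)
    (hcyc : ∀ U : Subgroup G, IsOpen (U : Set G) → U.FiniteIndex →
      ∀ a : ℤ, a ≠ 0 → ∃ g ∈ U, χcyclo g ^ a ≠ 1)
    (ρV : G →* (V ≃ₗ[K] V)) {C : Submodule K V} (hC : IsStable ρV C)
    (hCt : ∃ U : Subgroup G, IsOpen (U : Set G) ∧ U.FiniteIndex ∧
      ∀ g ∈ U, ∀ c ∈ C, ρV g c = (χcyclo g : K) • c)
    (ρP : G →* ((V ⧸ C) ≃ₗ[K] (V ⧸ C))) (hρP : ∀ (g : G) (m : V), ρP g (C.mkQ m) = C.mkQ (ρV g m))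
    (B : (V ⧸ C) →ₗ[K] (V ⧸ C) →ₗ[K] K)
    (hB : ∀ (g : G) (p q : V ⧸ C), B (ρP g p) (ρP g q) = (χcyclo g : K) * B p q)
    (hBl : ∀ p : V ⧸ C, (∀ q : V ⧸ C, B p q = 0) → p = 0) :
    CuspCountViaWeights χcyclo ρV (Module.finrank K ↥C + 1) := by
  obtain ⟨ρC, hρC⟩ := exists_subrepresentation ρV hC
  have hσC := scalarOn_sub_of_quasiToral hρC hCt
  have h1 : quasiTrivialRank (twist ρV χcyclo⁻¹) =
      Module.finrank K ↥C + quasiTrivialRank (twist ρP χcyclo⁻¹) := by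
    rw [quasiTrivialRank_twist_eq_add hC hρC hρP, quasiTrivialRank_twist_inv_of_quasiToral hσC]
  have h2 : quasiTrivialRank ρV = quasiTrivialRank ρP := by
    rw [quasiTrivialRank_eq_add_of_exact ρV hC ρC hρC ρP hρP, quasiTrivialRank_of_quasiToral hcyc hσC,
      zero_add]
  have e : (χcyclo * χcyclo⁻¹)⁻¹ = 1 := by ext g; simp
  have h3 : quasiTrivialRank (twist ρP χcyclo⁻¹) = quasiTrivialRank ρP := by
    rw [quasiTrivialRank_twist_inv_eq_of_pairing ρP B hB hBl χcyclo, e, twist_one]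
  unfold CuspCountViaWeights
  rw [h1, h2, h3]
  push_cast
  ring

/-- **SUB-NODE A3 ([CombGC] Prop. 2.4 (iii)) DERIVED for the Poincaré extension**:
`det(V)² = (χ^{cyclo})^{dim V + dim C}` on the open subgroup of finite index where `C` is `χ^{cyclo}`-
isotypic (`det V = det C · det(V/C)`, `det C = χ^{dim C}` there, `det(V/C)² = χ^{dim V/C}` by duality);
`0 < m := dim V + dim C ≤ 2·dim V`. [cite: MochizukiCombGC2007, Prop. 2.4 (iii) p.19]
[cite: MochizukiAbsTopI2012, Lemma 4.5 (iii) p.54] -/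
theorem detSqQuasiCyclotomic_of_poincareExtension [FiniteDimensional K V] (χcyclo : G →* Kˣ)
    (ρV : G →* (V ≃ₗ[K] V)) (hV : 0 < Module.finrank K V) {C : Submodule K V} (hC : IsStable ρV C)
    (hCt : ∃ U : Subgroup G, IsOpen (U : Set G) ∧ U.FiniteIndex ∧
      ∀ g ∈ U, ∀ c ∈ C, ρV g c = (χcyclo g : K) • c)
    (ρP : G →* ((V ⧸ C) ≃ₗ[K] (V ⧸ C))) (hρP : ∀ (g : G) (m : V), ρP g (C.mkQ m) = C.mkQ (ρV g m))
    (B : (V ⧸ C) →ₗ[K] (V ⧸ C) →ₗ[K] K)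
    (hB : ∀ (g : G) (p q : V ⧸ C), B (ρP g p) (ρP g q) = (χcyclo g : K) * B p q)
    (hBl : ∀ p : V ⧸ C, (∀ q : V ⧸ C, B p q = 0) → p = 0) :
    DetSqQuasiCyclotomic χcyclo ρV := by
  obtain ⟨ρC, hρC⟩ := exists_subrepresentation ρV hC
  obtain ⟨U, hU, hfi, hact⟩ := scalarOn_sub_of_quasiToral hρC hCt
  have hdim := C.finrank_quotient_add_finrank
  have hle := C.finrank_le
  refine ⟨Module.finrank K V + Module.finrank K ↥C, by omega, by omega, U, hU, hfi, fun g hg => ?_⟩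
  have hCdet : detChar ρC g = χcyclo g ^ Module.finrank K ↥C := by
    apply Units.ext
    have hlin : ((ρC g : ↥C ≃ₗ[K] ↥C) : ↥C →ₗ[K] ↥C) = (χcyclo g : K) • LinearMap.id := by
      apply LinearMap.ext
      intro c
      rw [LinearEquiv.coe_coe, hact g hg c, LinearMap.smul_apply, LinearMap.id_apply]
    show ((LinearEquiv.det (ρC g) : Kˣ) : K) = _
    rw [LinearEquiv.coe_det, hlin, LinearMap.det_smul, LinearMap.det_id, mul_one,
      Units.val_pow_eq_pow_val]
  rw [detChar_eq_mul_of_extension hC hρC hρP g, mul_pow, hCdet, detChar_sq_eq_of_pairing ρP B hB hBl g,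
    ← pow_mul, ← pow_add]
  congr 1
  omega

/-! ### §2. Hence the three sentences of [AbsTopI] Lemma 4.5 (iii) (F-0224 · F-0223 · F-0222) for every
Poincaré extension, via the PROVED assembly sub-nodes A4, A8 (+ A1, A5, A6), A11 (+ A10) -/

/-- **F-0224 `Lem45iii_det` for the Poincaré extension**: the determinant character is `ℚ`-cyclotomic of
positive weight. [cite: MochizukiAbsTopI2012, Lemma 4.5 (iii) p.54] [cite: MochizukiCombGC2007, Prop. 2.4 (iv) p.19] -/
theorem lem45iii_det_of_poincareExtension [FiniteDimensional K V] (χcyclo : G →* Kˣ)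
    (ρV : G →* (V ≃ₗ[K] V)) (hV : 0 < Module.finrank K V) {C : Submodule K V} (hC : IsStable ρV C)
    (hCt : ∃ U : Subgroup G, IsOpen (U : Set G) ∧ U.FiniteIndex ∧
      ∀ g ∈ U, ∀ c ∈ C, ρV g c = (χcyclo g : K) • c)
    (ρP : G →* ((V ⧸ C) ≃ₗ[K] (V ⧸ C))) (hρP : ∀ (g : G) (m : V), ρP g (C.mkQ m) = C.mkQ (ρV g m))
    (B : (V ⧸ C) →ₗ[K] (V ⧸ C) →ₗ[K] K)
    (hB : ∀ (g : G) (p q : V ⧸ C), B (ρP g p) (ρP g q) = (χcyclo g : K) * B p q)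
    (hBl : ∀ p : V ⧸ C, (∀ q : V ⧸ C, B p q = 0) → p = 0) :
    Lem45iii_det χcyclo ρV :=
  detQCyclotomicOfDetSq_holds χcyclo ρV
    (detSqQuasiCyclotomic_of_poincareExtension χcyclo ρV hV hC hCt ρP hρP B hB hBl)

/-- **F-0223 `Lem45iii_cycloClass` for the Poincaré extension** (with `C ≠ 0`, i.e. `r ≥ 2` cusps —
necessary: at `C = 0` the proper / once-punctured shapes fail, `AbsTopICharacterRankProperShape`): the
realised weights have a maximum and the minimum `0`, summing to `2`, and every `χ^* · χ_*` is
power-equivalent to `χ^{cyclo}`. [cite: MochizukiAbsTopI2012, Lemma 4.5 (iii) p.54]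
[cite: MochizukiCombGC2007, Cor. 2.7 (i) proof p.23] -/
theorem lem45iii_cycloClass_of_poincareExtension [FiniteDimensional K V] (χcyclo : G →* Kˣ)
    (hcyc : ∀ U : Subgroup G, IsOpen (U : Set G) → U.FiniteIndex →
      ∀ a : ℤ, a ≠ 0 → ∃ g ∈ U, χcyclo g ^ a ≠ 1)
    (ρV : G →* (V ≃ₗ[K] V)) {C : Submodule K V} (hC : IsStable ρV C) (hC0 : C ≠ ⊥)
    (hCt : ∃ U : Subgroup G, IsOpen (U : Set G) ∧ U.FiniteIndex ∧
      ∀ g ∈ U, ∀ c ∈ C, ρV g c = (χcyclo g : K) • c)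
    (ρP : G →* ((V ⧸ C) ≃ₗ[K] (V ⧸ C))) (hρP : ∀ (g : G) (m : V), ρP g (C.mkQ m) = C.mkQ (ρV g m))
    (B : (V ⧸ C) →ₗ[K] (V ⧸ C) →ₗ[K] K)
    (hB : ∀ (g : G) (p q : V ⧸ C), B (ρP g p) (ρP g q) = (χcyclo g : K) * B p q)
    (hBl : ∀ p : V ⧸ C, (∀ q : V ⧸ C, B p q = 0) → p = 0) :
    Lem45iii_cycloClass χcyclo ρV :=
  cycloClassOfSymmetry_holds χcyclo ρV (sameWeightPowerEquivalent_holds χcyclo)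
    (cycloWeightTwoTrivialWeightZero_holds χcyclo) (zeroWeightRealised_holds χcyclo ρV)
    (realisedWeightsSymmetric_of_poincareExtension χcyclo hcyc ρV hC hC0 hCt ρP hρP B hB hBl)

/-- **F-0222 `Lem45iii_cuspCount` for the Poincaré extension**: with `r := dim C + 1` cusps,
`r = d_{χ^{cyclo}}(V) + 1`. [cite: MochizukiAbsTopI2012, Lemma 4.5 (iii) p.54]
[cite: MochizukiCombGC2007, Cor. 2.7 (i) proof p.23] -/
theorem lem45iii_cuspCount_of_poincareExtension [FiniteDimensional K V] (χcyclo : G →* Kˣ)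
    (hcyc : ∀ U : Subgroup G, IsOpen (U : Set G) → U.FiniteIndex →
      ∀ a : ℤ, a ≠ 0 → ∃ g ∈ U, χcyclo g ^ a ≠ 1)
    (ρV : G →* (V ≃ₗ[K] V)) {C : Submodule K V} (hC : IsStable ρV C)
    (hCt : ∃ U : Subgroup G, IsOpen (U : Set G) ∧ U.FiniteIndex ∧
      ∀ g ∈ U, ∀ c ∈ C, ρV g c = (χcyclo g : K) • c)
    (ρP : G →* ((V ⧸ C) ≃ₗ[K] (V ⧸ C))) (hρP : ∀ (g : G) (m : V), ρP g (C.mkQ m) = C.mkQ (ρV g m))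
    (B : (V ⧸ C) →ₗ[K] (V ⧸ C) →ₗ[K] K)
    (hB : ∀ (g : G) (p q : V ⧸ C), B (ρP g p) (ρP g q) = (χcyclo g : K) * B p q)
    (hBl : ∀ p : V ⧸ C, (∀ q : V ⧸ C, B p q = 0) → p = 0) :
    Lem45iii_cuspCount χcyclo ρV (Module.finrank K ↥C + 1) :=
  cuspCountOfWeights_holds χcyclo ρV _
    (cuspCountViaWeights_of_poincareExtension χcyclo hcyc ρV hC hCt ρP hρP B hB hBl) (dualRankEq_holds ρV)

/-- **`d_{χ^{cyclo}}(V) = dim C`** ("`d_χ(H^{ab} ⊗ ℚ_l)`" of [AbsTopI] Lemma 4.5 (ii) is the rank of the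
cuspidal part `M^{cusp} ⊗ ℚ_l`, i.e. `r − 1`). [cite: MochizukiAbsTopI2012, Lemma 4.5 (ii)(iii) p.54]
[cite: MochizukiCombGC2007, Rmk. 1.3.1 p.10] -/
theorem dChi_of_poincareExtension [FiniteDimensional K V] (χcyclo : G →* Kˣ)
    (hcyc : ∀ U : Subgroup G, IsOpen (U : Set G) → U.FiniteIndex →
      ∀ a : ℤ, a ≠ 0 → ∃ g ∈ U, χcyclo g ^ a ≠ 1)
    (ρV : G →* (V ≃ₗ[K] V)) {C : Submodule K V} (hC : IsStable ρV C)
    (hCt : ∃ U : Subgroup G, IsOpen (U : Set G) ∧ U.FiniteIndex ∧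
      ∀ g ∈ U, ∀ c ∈ C, ρV g c = (χcyclo g : K) • c)
    (ρP : G →* ((V ⧸ C) ≃ₗ[K] (V ⧸ C))) (hρP : ∀ (g : G) (m : V), ρP g (C.mkQ m) = C.mkQ (ρV g m))
    (B : (V ⧸ C) →ₗ[K] (V ⧸ C) →ₗ[K] K)
    (hB : ∀ (g : G) (p q : V ⧸ C), B (ρP g p) (ρP g q) = (χcyclo g : K) * B p q)
    (hBl : ∀ p : V ⧸ C, (∀ q : V ⧸ C, B p q = 0) → p = 0) :
    dChi ρV χcyclo = Module.finrank K ↥C := by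
  have h := lem45iii_cuspCount_of_poincareExtension χcyclo hcyc ρV hC hCt ρP hρP B hB hBl
  unfold Lem45iii_cuspCount at h
  push_cast at h
  linarith

end PoincareExtension

end Literature.AnabelianGeometry.AbsoluteAnabelian.AbsTopI

end
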